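import Mathlib
import Literature.Analysis.FunctionSpaces.CsiszarKullbackPinsker
import HarnessLib

/-!
# Route `EntropyBudgetEquipartition`, crux `EntropyBudgetTransfer` (stmt-QuantumFields-22401) — helper «KT3 → KT»,
# part 1: covariance transfer from closeness of the pair laws (abstract measure theory)

HONEST LABEL: bookkeeping toward a RECORD-label rung (R2ξ-G, `WeakCouplingRates.XiPow`, an UPPER bound on the
lattice gap); nothing in this file bears on the Yang–Mills mass gap, and nothing in it is specific to gauge
theories.

The route's two-layer plan for the crux (`Theses/EntropyBudgetEquipartition.lean`, KT ⇐ KT1 → KT2 → KT3) ends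
with «patch laws within total variation `β^{−κ''}` (Csiszár chain rule + Pinsker) ⇒ the two-sided law for
`β² Cov(c₀, c_n)`». The plaquette costs are bounded (`0 ≤ c ≤ 2N`) but the precision asked (`β^{−κ'}` for
`β² Cov`, i.e. `β^{−2−κ'}` for `Cov`) is finer than the sup norm allows, so the last arrow is a TRUNCATION
argument: clip `β c` at a level `m = O(log β)`, compare the clipped covariances through bounded test functions,
and pay the clipped-off part with exponential tails. This file is that arrow, abstractly; part 2
(`EntropyBudgetEquipartitionCovTransferTorus.lean`) instantiates it on the torus Wilson state with the tree's
all-`G` chessboard plaquette tail.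

* §1 (one law) `abs_cov_sub_cov_min_le` — for measurable `0 ≤ X, Y ≤ M` on a probability space and `m ≥ 0`,
  `|Cov(X,Y) − Cov(X∧m, Y∧m)| ≤ 2M² (P{m < X} + P{m < Y})`;
* §2 (two laws) `abs_cov_min_sub_cov_min_le` — if the joint laws of `(X,Y)` under `P` and `(X',Y')` under `Q`
  are `δ`-close on measurable test functions `|h| ≤ 1` of the pair, the clipped covariances differ by `≤ 3m²δ`;
  `abs_cov_sub_cov_le` — the combination
  `|Cov_P(X,Y) − Cov_Q(X',Y')| ≤ 3m²δ + 2M² (P{m<X} + P{m<Y} + Q{m<X'} + Q{m<Y'})`;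
* §3 `abs_integral_sub_integral_le_sqrt_klDiv` — Pinsker in test-function form for Mathlib's `klDiv`,
  `|∫ h dμ − ∫ h dν| ≤ √(2 D(μ‖ν))` (the tree's density form
  `Literature.Analysis.FunctionSpaces.integral_abs_sub_le_sqrt` at `f = dμ/dν`, `g = 1`), and §3b
  `abs_integral_pair_sub_le_sqrt_klDiv_map` — the same for the push-forward laws of the two pairs, so that a
  relative-entropy bound `D(law_P(X,Y) ‖ law_Q(X',Y')) ≤ ε` feeds §2 with `δ = √(2ε)`.

What is NOT here: any relative-entropy budget for the Yang–Mills state (KT2), any localisation of it (KT3), any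
Gaussian computation (the constant `σ C(n)²`): the reference pair `(X', Y')`, its law and its tails are free
parameters. Written by the width seat 2/3 of line `ym-line-ebe-p1` as `--supports stmt-QuantumFields-22401`.
References: S. Boucheron, G. Lugosi, P. Massart, *Concentration Inequalities*, OUP 2013, Thm. 4.19 (Pinsker)
[BoucheronLugosiMassart2013]; I. Csiszár, J. Körner, *Information Theory*, CUP 2011 [CsiszarKorner2011].
-/

set_option autoImplicit false

noncomputable section

open MeasureTheory Set

namespace Summit.QuantumFields.YangMills.Theorems.EntropyBudgetEquipartition.CovTransfer

/-! ### §1 Truncation: covariance of bounded non-negative observables vs. their clips at level `m` -/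

section OneMeasure

variable {E : Type*} [MeasurableSpace E] {P : Measure E} [IsProbabilityMeasure P]

/-- Pointwise: for `0 ≤ x, y ≤ M` and `0 ≤ m`, `|x y − (x ∧ m)(y ∧ m)| ≤ M² (𝟙[m < x] + 𝟙[m < y])`. [folklore] -/
theorem abs_mul_sub_min_mul_min_le {x y M m : ℝ} (hx0 : 0 ≤ x) (hxM : x ≤ M) (hy0 : 0 ≤ y) (hyM : y ≤ M)
    (hm : 0 ≤ m) :
    |x * y - min x m * min y m| ≤
      M ^ 2 * ((if m < x then (1 : ℝ) else 0) + (if m < y then (1 : ℝ) else 0)) := by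
  have hM : 0 ≤ M := hx0.trans hxM
  by_cases hx : m < x
  · rw [if_pos hx]
    have h1 : |x * y - min x m * min y m| ≤ M ^ 2 := by
      rw [abs_le]; constructor
      · have : min x m * min y m ≤ M * M :=
          mul_le_mul ((min_le_left _ _).trans hxM) ((min_le_left _ _).trans hyM) (le_min hy0 hm) hM
        nlinarith [mul_nonneg hx0 hy0]
      · have : x * y ≤ M * M := mul_le_mul hxM hyM hy0 hM
        nlinarith [mul_nonneg (le_min hx0 hm) (le_min hy0 hm)]
    refine h1.trans ?_
    have h2 : (0 : ℝ) ≤ (if m < y then (1 : ℝ) else 0) := by split_ifs <;> norm_num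
    nlinarith [sq_nonneg M]
  · rw [if_neg hx, min_eq_left (not_lt.1 hx)]
    by_cases hy : m < y
    · rw [if_pos hy]
      have h1 : |x * y - x * min y m| ≤ M ^ 2 := by
        rw [← mul_sub, abs_mul, abs_of_nonneg hx0, sq]
        refine mul_le_mul hxM ?_ (abs_nonneg _) hM
        rw [abs_le]; constructor
        · nlinarith [min_le_left y m, (le_min hy0 hm : 0 ≤ min y m)]
        · nlinarith [min_le_left y m, (le_min hy0 hm : 0 ≤ min y m)]
      linarith
    · rw [if_neg hy, min_eq_left (not_lt.1 hy)]; norm_num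

omit [MeasurableSpace E] [IsProbabilityMeasure P] in
/-- The indicator `𝟙[m < X]` as an `ite`. [folklore] -/
theorem indicator_lt_eq_ite {X : E → ℝ} (m : ℝ) (e : E) :
    ({e | m < X e} : Set E).indicator (1 : E → ℝ) e = if m < X e then (1 : ℝ) else 0 := by
  by_cases h : m < X e
  · rw [if_pos h, Set.indicator_of_mem (show e ∈ {e | m < X e} from h)]; rfl
  · rw [if_neg h, Set.indicator_of_notMem (show e ∉ {e | m < X e} from h)]

omit [IsProbabilityMeasure P] in
/-- The indicator `𝟙[m < X]` integrates to `P{m < X}`. [folklore] -/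
theorem integral_ite_lt_eq_measureReal {X : E → ℝ} (hX : Measurable X) (m : ℝ) :
    ∫ e, (if m < X e then (1 : ℝ) else 0) ∂P = P.real {e | m < X e} := by
  have hS : MeasurableSet {e | m < X e} := measurableSet_lt measurable_const hX
  rw [← integral_indicator_one hS]
  exact integral_congr_ae (ae_of_all _ fun e => (indicator_lt_eq_ite (X := X) m e).symm)

omit [IsProbabilityMeasure P] in
/-- `Integrable` of the indicator `𝟙[m < X]` (finite measure). [folklore] -/
theorem integrable_ite_lt [IsFiniteMeasure P] {X : E → ℝ} (hX : Measurable X) (m : ℝ) :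
    Integrable (fun e => if m < X e then (1 : ℝ) else 0) P := by
  have hS : MeasurableSet {e | m < X e} := measurableSet_lt measurable_const hX
  have h := (integrable_const (μ := P) (1 : ℝ)).indicator hS
  refine h.congr (ae_of_all _ fun e => ?_)
  exact indicator_lt_eq_ite (X := X) m e

/-- A measurable function with `0 ≤ X ≤ M` is integrable on a probability space. [folklore] -/
theorem integrable_of_nonneg_le {X : E → ℝ} (hX : Measurable X) {M : ℝ} (hX0 : ∀ e, 0 ≤ X e)
    (hXM : ∀ e, X e ≤ M) : Integrable X P :=
  Integrable.of_bound hX.aestronglyMeasurable M (ae_of_all _ fun e => by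
    rw [Real.norm_eq_abs, abs_of_nonneg (hX0 e)]; exact hXM e)

/-- **Truncation of the second moment**: for measurable `0 ≤ X, Y ≤ M` and `m ≥ 0`,
`|E[XY] − E[(X∧m)(Y∧m)]| ≤ M² (P{m < X} + P{m < Y})`. [folklore] -/
theorem abs_integral_mul_sub_integral_min_mul_min_le {X Y : E → ℝ} (hX : Measurable X) (hY : Measurable Y)
    {M m : ℝ} (hX0 : ∀ e, 0 ≤ X e) (hXM : ∀ e, X e ≤ M) (hY0 : ∀ e, 0 ≤ Y e) (hYM : ∀ e, Y e ≤ M)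
    (hm : 0 ≤ m) :
    |∫ e, X e * Y e ∂P - ∫ e, min (X e) m * min (Y e) m ∂P| ≤
      M ^ 2 * (P.real {e | m < X e} + P.real {e | m < Y e}) := by
  have hXm : Measurable fun e => min (X e) m := hX.min measurable_const
  have hYm : Measurable fun e => min (Y e) m := hY.min measurable_const
  have iXY : Integrable (fun e => X e * Y e) P :=
    integrable_of_nonneg_le (hX.mul hY) (M := M * M) (fun e => mul_nonneg (hX0 e) (hY0 e))
      (fun e => mul_le_mul (hXM e) (hYM e) (hY0 e) ((hX0 e).trans (hXM e)))
  have iXYm : Integrable (fun e => min (X e) m * min (Y e) m) P :=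
    integrable_of_nonneg_le (hXm.mul hYm) (M := M * M)
      (fun e => mul_nonneg (le_min (hX0 e) hm) (le_min (hY0 e) hm))
      (fun e => mul_le_mul ((min_le_left _ _).trans (hXM e)) ((min_le_left _ _).trans (hYM e))
        (le_min (hY0 e) hm) ((hX0 e).trans (hXM e)))
  have iI : Integrable (fun e => M ^ 2 * ((if m < X e then (1 : ℝ) else 0) + (if m < Y e then (1 : ℝ) else 0))) P :=
    ((integrable_ite_lt hX m).add (integrable_ite_lt hY m)).const_mul (M ^ 2)
  rw [← integral_sub iXY iXYm]
  calc |∫ e, (X e * Y e - min (X e) m * min (Y e) m) ∂P|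
      ≤ ∫ e, |X e * Y e - min (X e) m * min (Y e) m| ∂P := abs_integral_le_integral_abs
    _ ≤ ∫ e, M ^ 2 * ((if m < X e then (1 : ℝ) else 0) + (if m < Y e then (1 : ℝ) else 0)) ∂P :=
        integral_mono (iXY.sub iXYm).abs iI fun e =>
          abs_mul_sub_min_mul_min_le (hX0 e) (hXM e) (hY0 e) (hYM e) hm
    _ = M ^ 2 * (P.real {e | m < X e} + P.real {e | m < Y e}) := by
        rw [integral_const_mul, integral_add (integrable_ite_lt hX m) (integrable_ite_lt hY m),
          integral_ite_lt_eq_measureReal hX, integral_ite_lt_eq_measureReal hY]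

/-- **Truncation of the first moment**: for measurable `0 ≤ X ≤ M` and `m ≥ 0`,
`0 ≤ E[X] − E[X ∧ m] ≤ M · P{m < X}`. [folklore] -/
theorem integral_sub_integral_min_mem {X : E → ℝ} (hX : Measurable X) {M m : ℝ} (hX0 : ∀ e, 0 ≤ X e)
    (hXM : ∀ e, X e ≤ M) (hm : 0 ≤ m) :
    0 ≤ ∫ e, X e ∂P - ∫ e, min (X e) m ∂P ∧
      ∫ e, X e ∂P - ∫ e, min (X e) m ∂P ≤ M * P.real {e | m < X e} := by
  have hXm : Measurable fun e => min (X e) m := hX.min measurable_const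
  have iX : Integrable X P := integrable_of_nonneg_le hX hX0 hXM
  have iXm : Integrable (fun e => min (X e) m) P :=
    integrable_of_nonneg_le hXm (M := M) (fun e => le_min (hX0 e) hm) (fun e => (min_le_left _ _).trans (hXM e))
  rw [← integral_sub iX iXm]
  refine ⟨integral_nonneg fun e => sub_nonneg.2 (min_le_left _ _), ?_⟩
  calc ∫ e, (X e - min (X e) m) ∂P ≤ ∫ e, M * (if m < X e then (1 : ℝ) else 0) ∂P := by
        refine integral_mono (iX.sub iXm) ((integrable_ite_lt hX m).const_mul M) fun e => ?_
        by_cases h : m < X e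
        · simp only [if_pos h, mul_one]; linarith [hXM e, le_min (hX0 e) hm]
        · simp only [if_neg h, mul_zero, min_eq_left (not_lt.1 h), sub_self, le_refl]
    _ = M * P.real {e | m < X e} := by rw [integral_const_mul, integral_ite_lt_eq_measureReal hX]

/-- **Truncation of the covariance**: for measurable `0 ≤ X, Y ≤ M` on a probability space and
`m ≥ 0`, `|Cov(X, Y) − Cov(X ∧ m, Y ∧ m)| ≤ 2 M² (P{m < X} + P{m < Y})`. [folklore] -/
theorem abs_cov_sub_cov_min_le {X Y : E → ℝ} (hX : Measurable X) (hY : Measurable Y)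
    {M m : ℝ} (hM : 0 ≤ M) (hX0 : ∀ e, 0 ≤ X e) (hXM : ∀ e, X e ≤ M) (hY0 : ∀ e, 0 ≤ Y e)
    (hYM : ∀ e, Y e ≤ M) (hm : 0 ≤ m) :
    |(∫ e, X e * Y e ∂P - (∫ e, X e ∂P) * (∫ e, Y e ∂P)) -
        (∫ e, min (X e) m * min (Y e) m ∂P - (∫ e, min (X e) m ∂P) * (∫ e, min (Y e) m ∂P))| ≤
      2 * M ^ 2 * (P.real {e | m < X e} + P.real {e | m < Y e}) := by
  have h2 := abs_integral_mul_sub_integral_min_mul_min_le (P := P) hX hY hX0 hXM hY0 hYM hm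
  obtain ⟨aX0, aX⟩ := integral_sub_integral_min_mem (P := P) hX hX0 hXM hm
  obtain ⟨aY0, aY⟩ := integral_sub_integral_min_mem (P := P) hY hY0 hYM hm
  -- sizes of the means
  have mY : 0 ≤ ∫ e, Y e ∂P ∧ ∫ e, Y e ∂P ≤ M := by
    refine ⟨integral_nonneg hY0, ?_⟩
    calc ∫ e, Y e ∂P ≤ ∫ e, M ∂P := integral_mono (integrable_of_nonneg_le hY hY0 hYM) (integrable_const M) hYM
      _ = M := by simp
  have mXm : 0 ≤ ∫ e, min (X e) m ∂P ∧ ∫ e, min (X e) m ∂P ≤ M := by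
    refine ⟨integral_nonneg fun e => le_min (hX0 e) hm, ?_⟩
    calc ∫ e, min (X e) m ∂P ≤ ∫ e, M ∂P :=
          integral_mono (integrable_of_nonneg_le (hX.min measurable_const) (M := M)
            (fun e => le_min (hX0 e) hm) (fun e => (min_le_left _ _).trans (hXM e))) (integrable_const M)
            fun e => (min_le_left _ _).trans (hXM e)
      _ = M := by simp
  have pX : 0 ≤ P.real {e | m < X e} := measureReal_nonneg
  have pY : 0 ≤ P.real {e | m < Y e} := measureReal_nonneg
  -- the product of the means
  have hprod : |(∫ e, X e ∂P) * (∫ e, Y e ∂P) - (∫ e, min (X e) m ∂P) * (∫ e, min (Y e) m ∂P)| ≤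
      M ^ 2 * (P.real {e | m < X e} + P.real {e | m < Y e}) := by
    have e1 : (∫ e, X e ∂P) * (∫ e, Y e ∂P) - (∫ e, min (X e) m ∂P) * (∫ e, min (Y e) m ∂P) =
        (∫ e, X e ∂P - ∫ e, min (X e) m ∂P) * (∫ e, Y e ∂P) +
          (∫ e, min (X e) m ∂P) * (∫ e, Y e ∂P - ∫ e, min (Y e) m ∂P) := by ring
    have u1 : (∫ e, X e ∂P - ∫ e, min (X e) m ∂P) * (∫ e, Y e ∂P) ≤ M * P.real {e | m < X e} * M :=
      (mul_le_mul_of_nonneg_right aX mY.1).trans (mul_le_mul_of_nonneg_left mY.2 (mul_nonneg hM pX))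
    have u2 : (∫ e, min (X e) m ∂P) * (∫ e, Y e ∂P - ∫ e, min (Y e) m ∂P) ≤ M * (M * P.real {e | m < Y e}) :=
      (mul_le_mul_of_nonneg_left aY mXm.1).trans (mul_le_mul_of_nonneg_right mXm.2 (mul_nonneg hM pY))
    have l1 : 0 ≤ (∫ e, X e ∂P - ∫ e, min (X e) m ∂P) * (∫ e, Y e ∂P) := mul_nonneg aX0 mY.1
    have l2 : 0 ≤ (∫ e, min (X e) m ∂P) * (∫ e, Y e ∂P - ∫ e, min (Y e) m ∂P) := mul_nonneg mXm.1 aY0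
    rw [e1, abs_le]
    constructor
    · nlinarith [mul_nonneg (sq_nonneg M) (add_nonneg pX pY)]
    · nlinarith
  have e2 : (∫ e, X e * Y e ∂P - (∫ e, X e ∂P) * (∫ e, Y e ∂P)) -
        (∫ e, min (X e) m * min (Y e) m ∂P - (∫ e, min (X e) m ∂P) * (∫ e, min (Y e) m ∂P)) =
      (∫ e, X e * Y e ∂P - ∫ e, min (X e) m * min (Y e) m ∂P) -
        ((∫ e, X e ∂P) * (∫ e, Y e ∂P) - (∫ e, min (X e) m ∂P) * (∫ e, min (Y e) m ∂P)) := by ring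
  rw [e2]
  exact (abs_sub _ _).trans (by linarith)

end OneMeasure

/-! ### §2 Two laws close on bounded test functions: the clipped covariances are close -/

section TwoMeasures

variable {E E' : Type*} [MeasurableSpace E] [MeasurableSpace E'] {P : Measure E} {Q : Measure E'}
  [IsProbabilityMeasure P] [IsProbabilityMeasure Q]

/-- The clip `[x]₀^m = max 0 (min x m)` has `|[x]₀^m| ≤ m` for `m ≥ 0`. [folklore] -/
theorem abs_max_min_le {x m : ℝ} (hm : 0 ≤ m) : |max 0 (min x m)| ≤ m := by
  rw [abs_of_nonneg (le_max_left _ _)]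
  exact max_le hm (min_le_right _ _)

/-- **Closeness of the clipped covariances.** If the joint laws of `(X, Y)` under `P` and of `(X', Y')`
under `Q` are `δ`-close on measurable test functions bounded by `1`, then for `m > 0` and non-negative
observables, `|Cov_P(X∧m, Y∧m) − Cov_Q(X'∧m, Y'∧m)| ≤ 3 m² δ`. [folklore] -/
theorem abs_cov_min_sub_cov_min_le {X Y : E → ℝ} {X' Y' : E' → ℝ} (hX0 : ∀ e, 0 ≤ X e) (hY0 : ∀ e, 0 ≤ Y e)
    (hX'0 : ∀ e, 0 ≤ X' e) (hY'0 : ∀ e, 0 ≤ Y' e) {m δ : ℝ} (hm : 0 < m)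
    (hclose : ∀ h : ℝ × ℝ → ℝ, Measurable h → (∀ z, |h z| ≤ 1) →
      |∫ e, h (X e, Y e) ∂P - ∫ e, h (X' e, Y' e) ∂Q| ≤ δ) :
    |(∫ e, min (X e) m * min (Y e) m ∂P - (∫ e, min (X e) m ∂P) * (∫ e, min (Y e) m ∂P)) -
        (∫ e, min (X' e) m * min (Y' e) m ∂Q - (∫ e, min (X' e) m ∂Q) * (∫ e, min (Y' e) m ∂Q))| ≤
      3 * m ^ 2 * δ := by
  have hm0 : 0 ≤ m := hm.le
  have hm2 : 0 < m ^ 2 := by positivity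
  -- the three test functions
  set c : ℝ → ℝ := fun x => max 0 (min x m) with hc
  have hcm : Measurable c := measurable_const.max (measurable_id.min measurable_const)
  have hcX : ∀ e, c (X e) = min (X e) m := fun e => max_eq_right (le_min (hX0 e) hm0)
  have hcY : ∀ e, c (Y e) = min (Y e) m := fun e => max_eq_right (le_min (hY0 e) hm0)
  have hcX' : ∀ e, c (X' e) = min (X' e) m := fun e => max_eq_right (le_min (hX'0 e) hm0)
  have hcY' : ∀ e, c (Y' e) = min (Y' e) m := fun e => max_eq_right (le_min (hY'0 e) hm0)
  have habs : ∀ x, |c x| ≤ m := fun x => abs_max_min_le hm0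
  -- product test function
  have h1 := hclose (fun z => c z.1 * c z.2 / m ^ 2)
    (((hcm.comp measurable_fst).mul (hcm.comp measurable_snd)).div_const _) (fun z => by
      rw [abs_div, abs_of_pos hm2, div_le_one hm2, abs_mul, sq]
      exact mul_le_mul (habs _) (habs _) (abs_nonneg _) hm0)
  have h2 := hclose (fun z => c z.1 / m) ((hcm.comp measurable_fst).div_const _) (fun z => by
      rw [abs_div, abs_of_pos hm, div_le_one hm]; exact habs _)
  have h3 := hclose (fun z => c z.2 / m) ((hcm.comp measurable_snd).div_const _) (fun z => by
      rw [abs_div, abs_of_pos hm, div_le_one hm]; exact habs _)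
  simp only [hcX, hcY, hcX', hcY'] at h1 h2 h3
  rw [integral_div, integral_div, ← sub_div, abs_div, abs_of_pos hm2, div_le_iff₀ hm2] at h1
  rw [integral_div, integral_div, ← sub_div, abs_div, abs_of_pos hm, div_le_iff₀ hm] at h2 h3
  -- sizes of the clipped means
  have bP : |∫ e, min (Y e) m ∂P| ≤ m := by
    rw [abs_of_nonneg (integral_nonneg fun e => le_min (hY0 e) hm0)]
    calc ∫ e, min (Y e) m ∂P ≤ ∫ e, m ∂P := integral_mono_of_nonneg (ae_of_all _ fun e => le_min (hY0 e) hm0)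
          (integrable_const m) (ae_of_all _ fun e => min_le_right _ _)
      _ = m := by simp
  have bQ : |∫ e, min (X' e) m ∂Q| ≤ m := by
    rw [abs_of_nonneg (integral_nonneg fun e => le_min (hX'0 e) hm0)]
    calc ∫ e, min (X' e) m ∂Q ≤ ∫ e, m ∂Q := integral_mono_of_nonneg (ae_of_all _ fun e => le_min (hX'0 e) hm0)
          (integrable_const m) (ae_of_all _ fun e => min_le_right _ _)
      _ = m := by simp
  -- product of means
  have hprod : |(∫ e, min (X e) m ∂P) * (∫ e, min (Y e) m ∂P) - (∫ e, min (X' e) m ∂Q) * (∫ e, min (Y' e) m ∂Q)|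
      ≤ 2 * m ^ 2 * δ := by
    have e1 : (∫ e, min (X e) m ∂P) * (∫ e, min (Y e) m ∂P) - (∫ e, min (X' e) m ∂Q) * (∫ e, min (Y' e) m ∂Q) =
        (∫ e, min (X e) m ∂P - ∫ e, min (X' e) m ∂Q) * (∫ e, min (Y e) m ∂P) +
          (∫ e, min (X' e) m ∂Q) * (∫ e, min (Y e) m ∂P - ∫ e, min (Y' e) m ∂Q) := by ring
    rw [e1]
    refine (abs_add_le _ _).trans ?_
    rw [abs_mul, abs_mul]
    have t1 : |∫ e, min (X e) m ∂P - ∫ e, min (X' e) m ∂Q| * |∫ e, min (Y e) m ∂P| ≤ δ * m * m :=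
      mul_le_mul h2 bP (abs_nonneg _) ((abs_nonneg _).trans h2)
    have t2 : |∫ e, min (X' e) m ∂Q| * |∫ e, min (Y e) m ∂P - ∫ e, min (Y' e) m ∂Q| ≤ m * (δ * m) :=
      mul_le_mul bQ h3 (abs_nonneg _) ((abs_nonneg _).trans bQ)
    nlinarith
  have e2 : (∫ e, min (X e) m * min (Y e) m ∂P - (∫ e, min (X e) m ∂P) * (∫ e, min (Y e) m ∂P)) -
        (∫ e, min (X' e) m * min (Y' e) m ∂Q - (∫ e, min (X' e) m ∂Q) * (∫ e, min (Y' e) m ∂Q)) =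
      (∫ e, min (X e) m * min (Y e) m ∂P - ∫ e, min (X' e) m * min (Y' e) m ∂Q) -
        ((∫ e, min (X e) m ∂P) * (∫ e, min (Y e) m ∂P) - (∫ e, min (X' e) m ∂Q) * (∫ e, min (Y' e) m ∂Q)) := by
    ring
  rw [e2]
  exact (abs_sub _ _).trans (by nlinarith)

/-- **Covariance transfer** (the last arrow `KT3 → KT` of the route's plan, abstract form). Two probability
spaces, non-negative observables bounded by `M` on each; if the joint laws of the pairs are `δ`-close on
measurable test functions bounded by `1`, then for every truncation level `m > 0`
`|Cov_P(X, Y) − Cov_Q(X', Y')| ≤ 3 m² δ + 2 M² (P{m < X} + P{m < Y} + Q{m < X'} + Q{m < Y'})`. [folklore] -/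
theorem abs_cov_sub_cov_le {X Y : E → ℝ} {X' Y' : E' → ℝ} (hX : Measurable X) (hY : Measurable Y)
    (hX' : Measurable X') (hY' : Measurable Y') {M : ℝ} (hM : 0 ≤ M)
    (hX0 : ∀ e, 0 ≤ X e) (hXM : ∀ e, X e ≤ M) (hY0 : ∀ e, 0 ≤ Y e) (hYM : ∀ e, Y e ≤ M)
    (hX'0 : ∀ e, 0 ≤ X' e) (hX'M : ∀ e, X' e ≤ M) (hY'0 : ∀ e, 0 ≤ Y' e) (hY'M : ∀ e, Y' e ≤ M)
    {m δ : ℝ} (hm : 0 < m)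
    (hclose : ∀ h : ℝ × ℝ → ℝ, Measurable h → (∀ z, |h z| ≤ 1) →
      |∫ e, h (X e, Y e) ∂P - ∫ e, h (X' e, Y' e) ∂Q| ≤ δ) :
    |(∫ e, X e * Y e ∂P - (∫ e, X e ∂P) * (∫ e, Y e ∂P)) -
        (∫ e, X' e * Y' e ∂Q - (∫ e, X' e ∂Q) * (∫ e, Y' e ∂Q))| ≤
      3 * m ^ 2 * δ + 2 * M ^ 2 * (P.real {e | m < X e} + P.real {e | m < Y e} +
        Q.real {e | m < X' e} + Q.real {e | m < Y' e}) := by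
  have hP := abs_cov_sub_cov_min_le (P := P) hX hY hM hX0 hXM hY0 hYM hm.le
  have hQ := abs_cov_sub_cov_min_le (P := Q) hX' hY' hM hX'0 hX'M hY'0 hY'M hm.le
  have hPQ := abs_cov_min_sub_cov_min_le (P := P) (Q := Q) hX0 hY0 hX'0 hY'0 hm hclose
  rw [abs_le] at hP hQ hPQ ⊢
  constructor <;> nlinarith [hP.1, hP.2, hQ.1, hQ.2, hPQ.1, hPQ.2]

end TwoMeasures

/-! ### §3 Pinsker: a relative-entropy bound gives closeness on bounded test functions -/

section Pinsker

open InformationTheory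

variable {F : Type*} [MeasurableSpace F] {μ ν : Measure F} [IsProbabilityMeasure μ] [IsProbabilityMeasure ν]

/-- **Pinsker's inequality in test-function form**: for probability measures with `D(μ‖ν) < ∞` and a
measurable `h` with `|h| ≤ 1`, `|∫ h dμ − ∫ h dν| ≤ √(2 D(μ‖ν))` (the tree's density form
`Literature.Analysis.FunctionSpaces.integral_abs_sub_le_sqrt` at `f = dμ/dν`, `g = 1`).
[cite: BoucheronLugosiMassart2013, §4.11 Thm. 4.19] -/
theorem abs_integral_sub_integral_le_sqrt_klDiv (hkl : klDiv μ ν ≠ ⊤) {h : F → ℝ} (hh : Measurable h)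
    (hb : ∀ x, |h x| ≤ 1) :
    |∫ x, h x ∂μ - ∫ x, h x ∂ν| ≤ Real.sqrt (2 * (klDiv μ ν).toReal) := by
  obtain ⟨hac, hint⟩ := klDiv_ne_top_iff.1 hkl
  set f : F → ℝ := fun x => (μ.rnDeriv ν x).toReal with hf
  have hf0 : ∀ x, 0 ≤ f x := fun x => ENNReal.toReal_nonneg
  have hfi : Integrable f ν := Measure.integrable_toReal_rnDeriv
  have hmass : ∫ x, f x ∂ν = ∫ x, (fun _ => (1 : ℝ)) x ∂ν := by
    rw [hf, Measure.integral_toReal_rnDeriv hac]; simp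
  have hH : Integrable (fun x => f x * Real.log (f x / (fun _ => (1 : ℝ)) x)) ν := by
    simp only [div_one]
    exact (integrable_rnDeriv_mul_log_iff hac).2 hint
  have hpin := Literature.Analysis.FunctionSpaces.integral_abs_sub_le_sqrt (μ := ν) hf0 (fun _ => one_pos)
    hfi (integrable_const _) hH hmass
  have hKL : ∫ x, f x * Real.log (f x / (fun _ => (1 : ℝ)) x) ∂ν = (klDiv μ ν).toReal := by
    simp only [div_one]
    rw [hf, integral_rnDeriv_mul_log hac, toReal_klDiv_of_measure_eq hac]
    simp
  rw [hKL] at hpin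
  simp only [integral_const, probReal_univ, smul_eq_mul, mul_one] at hpin
  -- `∫ h dμ = ∫ f h dν`
  have hμ : ∫ x, h x ∂μ = ∫ x, f x * h x ∂ν := by rw [hf, integral_toReal_rnDeriv_mul hac]
  have hhi : Integrable h ν := Integrable.of_bound hh.aestronglyMeasurable 1
    (ae_of_all _ fun x => by rw [Real.norm_eq_abs]; exact hb x)
  have hfh : Integrable (fun x => f x * h x) ν := by
    rw [hf]; exact (integrable_toReal_rnDeriv_mul_iff hac).2
      (Integrable.of_bound hh.aestronglyMeasurable 1 (ae_of_all _ fun x => by rw [Real.norm_eq_abs]; exact hb x))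
  rw [hμ, ← integral_sub hfh hhi]
  calc |∫ x, (f x * h x - h x) ∂ν| ≤ ∫ x, |f x * h x - h x| ∂ν := abs_integral_le_integral_abs
    _ ≤ ∫ x, |f x - 1| ∂ν := by
        refine integral_mono (hfh.sub hhi).abs (hfi.sub (integrable_const _)).abs fun x => ?_
        have e1 : f x * h x - h x = (f x - 1) * h x := by ring
        rw [e1, abs_mul]
        exact mul_le_of_le_one_right (abs_nonneg _) (hb x)
    _ ≤ Real.sqrt (2 * (klDiv μ ν).toReal) := by simpa using hpin

end Pinsker

/-! ### §3b From a relative-entropy bound on the JOINT LAWS of the pairs to closeness on test functions -/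

section Laws

open InformationTheory

variable {E E' : Type*} [MeasurableSpace E] [MeasurableSpace E'] {P : Measure E} {Q : Measure E'}
  [IsProbabilityMeasure P] [IsProbabilityMeasure Q]

/-- **Pinsker for the pair laws.** If the joint law of `(X, Y)` under `P` has finite relative entropy
`D = D(law_P(X,Y) ‖ law_Q(X',Y'))` with respect to the joint law of `(X', Y')` under `Q`, the two laws are
`√(2D)`-close on measurable test functions bounded by `1` (`abs_integral_sub_integral_le_sqrt_klDiv` on
`ℝ × ℝ` and the change of variables `integral_map`). [cite: BoucheronLugosiMassart2013, §4.11 Thm. 4.19] -/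
theorem abs_integral_pair_sub_le_sqrt_klDiv_map {X Y : E → ℝ} {X' Y' : E' → ℝ} (hX : Measurable X)
    (hY : Measurable Y) (hX' : Measurable X') (hY' : Measurable Y')
    (hkl : klDiv (P.map fun e => (X e, Y e)) (Q.map fun e => (X' e, Y' e)) ≠ ⊤)
    (h : ℝ × ℝ → ℝ) (hh : Measurable h) (hb : ∀ z, |h z| ≤ 1) :
    |∫ e, h (X e, Y e) ∂P - ∫ e, h (X' e, Y' e) ∂Q| ≤
      Real.sqrt (2 * (klDiv (P.map fun e => (X e, Y e)) (Q.map fun e => (X' e, Y' e))).toReal) := by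
  have hf : Measurable fun e => (X e, Y e) := hX.prodMk hY
  have hg : Measurable fun e => (X' e, Y' e) := hX'.prodMk hY'
  haveI : IsProbabilityMeasure (P.map fun e => (X e, Y e)) := Measure.isProbabilityMeasure_map hf.aemeasurable
  haveI : IsProbabilityMeasure (Q.map fun e => (X' e, Y' e)) := Measure.isProbabilityMeasure_map hg.aemeasurable
  have h1 : ∫ z, h z ∂(P.map fun e => (X e, Y e)) = ∫ e, h (X e, Y e) ∂P :=
    integral_map hf.aemeasurable hh.aestronglyMeasurable
  have h2 : ∫ z, h z ∂(Q.map fun e => (X' e, Y' e)) = ∫ e, h (X' e, Y' e) ∂Q :=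
    integral_map hg.aemeasurable hh.aestronglyMeasurable
  rw [← h1, ← h2]
  exact abs_integral_sub_integral_le_sqrt_klDiv hkl hh hb

end Laws

end Summit.QuantumFields.YangMills.Theorems.EntropyBudgetEquipartition.CovTransfer

end
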